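import Summits.HodgeConjecture.HodgeConjecture.Theorems.WeilTwelvefoldsSqrtMinus7.Negative.EigenvalueTyping
import Literature.AlgebraicGeometry.Motives.AbelianVarietyProduct
import Literature.AlgebraicGeometry.Motives.AbelianVarietyProductDimProofs
import Literature.AlgebraicGeometry.Motives.AbelianVarietyProjectiveChart
import Literature.AlgebraicGeometry.Motives.ComplexPointsOrientation
import Literature.AlgebraicGeometry.HodgeTheory.WeilClassesProducts
import Literature.AlgebraicGeometry.HodgeTheory.GysinBaseChange
import Literature.AlgebraicGeometry.HodgeTheory.SupportedHodgeClassDescent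
import Literature.AlgebraicGeometry.HodgeTheory.AlgebraicClassesCupAbelianVariety
import HarnessLib

/-!
# Crux `WeilTwelvefoldsSqrtMinus7` (stmt-HodgeConjecture-1261), line `amnesic-secant-sheaves-split-fourteenfolds` — stub `stub_descent`

**Schoen's descent `14 → 12` for ONE partner surface, given Künneth for Hodge types** (C. Schoen, Compositio
Math. 114 (1998), §10; E. Markman, arXiv:2509.23403 §11.5 Step 2), PROVED on the tree's real carriers with the
REAL Gysin morphism `complexGysin μ` — no named fact taken; the premise is the registered stub `stub_hodgeTypeExterior`:
* `complexGysin_fst_map_snd_ne_zero` — Schoen's surjectivity "`ω_{5,σ₁} ∧ ω_{6,σ₁} ∧ ω_{5,σ₂} ∧ ω_{6,σ₂}`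
  is a basis for `H⁴(A')`": `pr_{X*} pr_Z^* w ≠ 0` for every non-zero top-degree `w` (Künneth spanning
  `kunnethSpan_complexBetti`, universal coefficients, Poincaré duality `OrientationFamily.hasPoincareDuality`);
* `mem_algebraicClasses_of_transfer` — the cycle `pr_{A*}(z · (A × D))`: divisors move on `A × B`
  (`AbelianVariety.cupProduct_mem_algebraicClasses_one`), Gysin images of algebraic classes are algebraic
  (`complexGysin_mem_algebraicClasses`), projection formula `complexGysin_cup`;
* `eigencomponents_mem_algebraicClasses` — the rational projector `q((𝟙+ψ)^*)` in the route's single-operator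
  typing (`(𝟙+ψ)^*` computed FACTORWISE, eigenvalues separated by `Negative.one_add_I_sqrt7_pow_ne`); `stub_descent`.
-/

noncomputable section

set_option linter.dupNamespace false

open CategoryTheory Complex
open Literature.AlgebraicGeometry Literature.AlgebraicGeometry.Motives
  Literature.AlgebraicGeometry.HodgeTheory Literature.AlgebraicTopology.SingularHomology

namespace Summit.HodgeConjecture.HodgeConjecture.Theorems.WeilTwelvefoldsSqrtMinus7.AmnesicSecantSheaves

section Gysin
open MonoidalCategory CartesianMonoidalCategory

/-- **Some top-degree class of `Z` has non-zero fibre integral** `pr_{X*}(pr_Z^* w) ∈ H⁰(X(ℂ); ℂ)`: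
`[(X ⊗ Z)(ℂ)] ≠ 0` pairs non-trivially with some class (universal coefficients over `ℂ`), hence with a
cross product `fst^* a ∪ snd^* w` (Künneth spanning), `a`, `w` of top degree, and
`⟨fst^* a ∪ snd^* w, [X ⊗ Z]⟩ = ⟨a, fst_*(snd^* w) ⌢ [X]⟩` (defining square of `fst_*`).
[cite: HatcherAT2002, §3.2 Thm. 3.15 and §3.1 Thm. 3.2] [cite: FultonYoungTableaux1997, Appendix B §B.1 (5)] -/
theorem exists_complexGysin_fst_map_snd_ne_zero (μ : OrientationFamily) {l n : ℕ} {X Z : SchemeOver ℂ}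
    (hX : IsSmoothProjective l X) (hZ : IsSmoothProjective n Z) :
    ∃ w : complexBetti Z (2 * n),
      complexGysin μ (IsSmoothProjective.tensor_holds hX hZ) hX (fst X Z)
        (show 2 * n + 2 * l = 0 + 2 * (l + n) by omega) (complexBetti.map (snd X Z) (2 * n) w) ≠ 0 := by
  have hμ : μ.HasPoincareDuality := OrientationFamily.hasPoincareDuality μ
  have hT := IsSmoothProjective.tensor_holds hX hZ
  letI := hT.chartedSpace
  haveI := ComplexPoints.compactSpace_of_isSmoothProjective hT
  haveI := ComplexPoints.t2Space_of_isSmoothProjective hT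
  haveI := connectedSpace_complexPoints hT
  set κ := kroneckerPairing ℂ ℂ (ComplexPoints (X ⊗ Z)) (2 * (l + n)) with hκ
  obtain ⟨φ, hφ⟩ : ∃ φ : Module.Dual ℂ (singularHomology ℂ ℂ (ComplexPoints (X ⊗ Z)) (2 * (l + n))),
      φ (μ hT).fundamentalClass ≠ 0 := by
    by_contra h
    push Not at h
    exact fundamentalClass_ne_zero (μ hT) ((Module.forall_dual_apply_eq_zero_iff ℂ _).1 h)
  obtain ⟨G₀, hG₀⟩ := kroneckerPairing_surjective ℂ (ComplexPoints (X ⊗ Z)) (2 * (l + n)) φ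
  have hG₀ne : κ G₀ (μ hT).fundamentalClass ≠ 0 := by rw [hκ, hG₀]; exact hφ
  by_contra hall
  push Not at hall
  apply hG₀ne
  -- the pairing with `[X ⊗ Z]` kills every cross product `fst^* a ∪ snd^* w`, `a`, `w` of top degree
  have key : ∀ (a : complexBetti X (2 * l)) (w : complexBetti Z (2 * n)),
      κ (cupProduct (show 2 * l + 2 * n = 2 * (l + n) by omega)
        (complexBetti.map (fst X Z) (2 * l) a) (complexBetti.map (snd X Z) (2 * n) w))
        (μ hT).fundamentalClass = 0 := by
    intro a w
    have hsign : ((-1 : ℂ) ^ (2 * l * (2 * n))) = 1 := Even.neg_one_pow ⟨l * (2 * n), by ring⟩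
    rw [cupProduct_gradedComm_holds ℂ _ _ (show 2 * n + 2 * l = 2 * (l + n) by omega), hsign, one_smul,
      hκ, kroneckerPairing_cupProduct]
    change kroneckerPairing ℂ ℂ _ _ (singularCohomology.map ℂ ℂ
      (AlgPoints.mapContinuous (L := ℂ) (fst X Z)) _ a) _ = 0
    rw [kroneckerPairing_map, ← capProduct_complexGysin hμ hT hX (fst X Z)
      (show 2 * n + 2 * l = 0 + 2 * (l + n) by omega) _ (Nat.zero_add _), hall w,
      map_zero, LinearMap.zero_apply, map_zero]
  -- hence (Künneth spanning) it kills everything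
  refine (Submodule.span_le.2 ?_ : _ ≤ LinearMap.ker (κ.flip (μ hT).fundamentalClass))
    (kunnethSpan_complexBetti hX hZ _ G₀)
  rintro _ ⟨i, j, h, a, w, rfl⟩
  rw [SetLike.mem_coe, LinearMap.mem_ker, LinearMap.flip_apply]
  rcases lt_trichotomy (2 * l) i with hi | rfl | hi
  · haveI := subsingleton_complexBetti hX hi
    rw [Subsingleton.elim a 0, map_zero, map_zero, LinearMap.zero_apply, map_zero, LinearMap.zero_apply]
  · obtain rfl : j = 2 * n := by omega
    exact key a w
  · haveI := subsingleton_complexBetti hZ (show 2 * n < j by omega)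
    rw [Subsingleton.elim w 0, map_zero, map_zero, map_zero, LinearMap.zero_apply]

/-- **Schoen's surjectivity `W_{A×A'} ⊗ W_{A'} → W_A ⊗ H⁴(A') → W_A`, on the carriers**: the fibre
integral `pr_{X*}(pr_Z^* w) ∈ H⁰(X(ℂ); ℂ)` of EVERY non-zero top-degree `w ∈ H²ⁿ(Z(ℂ); ℂ)` is non-zero
(`H²ⁿ(Z(ℂ))` is a line, `exists_eq_smul_of_top`; "`ω_{5,σ₁} ∧ ω_{6,σ₁} ∧ ω_{5,σ₂} ∧ ω_{6,σ₂}` is a basis for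
`H⁴(A'; ℂ)`"). [cite: Schoen1998HodgeWeilAddendum, §10 Proposition (proof)] [cite: HatcherAT2002, §3.3 Thm. 3.26] -/
theorem complexGysin_fst_map_snd_ne_zero (μ : OrientationFamily) {l n : ℕ} {X Z : SchemeOver ℂ}
    (hX : IsSmoothProjective l X) (hZ : IsSmoothProjective n Z) {w : complexBetti Z (2 * n)} (hw : w ≠ 0) :
    complexGysin μ (IsSmoothProjective.tensor_holds hX hZ) hX (fst X Z)
        (show 2 * n + 2 * l = 0 + 2 * (l + n) by omega) (complexBetti.map (snd X Z) (2 * n) w) ≠ 0 := by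
  obtain ⟨w₁, hw₁⟩ := exists_complexGysin_fst_map_snd_ne_zero μ hX hZ
  obtain ⟨t, rfl⟩ := exists_eq_smul_of_top μ hZ hw w₁
  intro h
  apply hw₁
  rw [map_smul, map_smul, h, smul_zero]

end Gysin

/-- A complex abelian variety of dimension `n` is smooth projective of dimension `n`
(`AbelianVariety.isSmoothProjective_holds`). [folklore] -/
theorem isSmoothProjective_of_dim_eq {A : AbelianVariety ℂ} {n : ℕ} (h : A.dim = n) :
    IsSmoothProjective n A.X :=
  h ▸ AbelianVariety.isSmoothProjective_holds (A := A)

/-- **Schoen's transfer (§10 of the Addendum), downward half, with the tree's real Gysin map.** For a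
complex abelian 12-fold `A`, a complex abelian surface `B`, `x ∈ H¹²(A(ℂ); ℂ)`, `b, η ∈ H²(B(ℂ); ℂ)` with
`η` algebraic and `b ⌣ η ≠ 0`: if `pr_A^* x ⌣ pr_B^* b ∈ N⁷H¹⁴((A × B)(ℂ))` then `x ∈ N⁶H¹²(A(ℂ))` —
`(pr_A^* x ⌣ pr_B^* b) ⌣ pr_B^* η ∈ N⁸` (flat pull-back; divisors move by a general translate on `A × B`),
its Gysin image under `pr_A` is algebraic and equals `x ⌣ pr_{A*}pr_B^*(b ⌣ η) = t · x`, `t ≠ 0`.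
[cite: Schoen1998HodgeWeilAddendum, §10 Proposition (proof)] [cite: Markman2025SurveySecant, §11.5 Step 2]
[cite: FultonYoungTableaux1997, Appendix B §B.1 (3) and (6)] [cite: VoisinHodgeII2003, Prop. 9.20 and Prop. 9.21 (ii)] -/
theorem mem_algebraicClasses_of_transfer {A B : AbelianVariety ℂ} (hA : A.dim = 12) (hB : B.dim = 2)
    {x : complexBetti A.X 12} {b η : complexBetti B.X 2} (hη : η ∈ algebraicClasses B.X 1)
    (hbη : cupProduct (show 2 + 2 = 4 from rfl) b η ≠ 0)
    (halg : cupProduct (show 12 + 2 = 14 from rfl)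
        (complexBetti.map (AbelianVariety.fst A B).hom.hom.hom 12 x)
        (complexBetti.map (AbelianVariety.snd A B).hom.hom.hom 2 b) ∈ algebraicClasses (A.prod B).X 7) :
    x ∈ algebraicClasses A.X 6 := by
  -- `ℂ`-orientations of the complex points of all smooth projective varieties, with Poincaré duality
  obtain ⟨μ, hμ⟩ : ∃ μ : OrientationFamily, μ.HasPoincareDuality :=
    ⟨fun _ _ h ↦ Classical.choice (Motives.ComplexPoints.isOrientableOver ℂ h),
      OrientationFamily.hasPoincareDuality _⟩
  have hA' : IsSmoothProjective 12 A.X := isSmoothProjective_of_dim_eq hA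
  have hB' : IsSmoothProjective 2 B.X := isSmoothProjective_of_dim_eq hB
  have hP : IsSmoothProjective (12 + 2) (A.prod B).X := IsSmoothProjective.tensor_holds hA' hB'
  -- `(pr_A^* x ∪ pr_B^* b) ∪ pr_B^* η` is algebraic (divisors move on `A × B`); push it forward along `pr_A`
  have h16 : cupProduct (show 14 + 2 = 16 from rfl)
      (cupProduct (show 12 + 2 = 14 from rfl) (complexBetti.map (AbelianVariety.fst A B).hom.hom.hom 12 x)
        (complexBetti.map (AbelianVariety.snd A B).hom.hom.hom 2 b))
      (complexBetti.map (AbelianVariety.snd A B).hom.hom.hom 2 η) ∈ algebraicClasses (A.prod B).X 8 :=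
    AbelianVariety.cupProduct_mem_algebraicClasses_one (A.prod B) (l := 7) halg
      (map_snd_mem_supportedClasses hA' hB' hη)
  have h12 := complexGysin_mem_algebraicClasses (gysinMap_restrictCompl_eq_zero_of_field ℂ) μ hμ hP hA'
    (AbelianVariety.fst A B).hom.hom.hom (q := 8) (p := 6) (by norm_num)
    (show 2 * 8 + 2 * 12 = 2 * 6 + 2 * (12 + 2) by norm_num) h16
  -- projection formula: `pr_{A*}((pr_A^* x ∪ pr_B^* b) ∪ pr_B^* η) = x ∪ ε`, `ε = pr_{A*} pr_B^*(b ∪ η)`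
  rw [cupProduct_assoc (show 12 + 2 = 14 from rfl) (show 2 + 2 = 4 from rfl) (show 14 + 2 = 16 from rfl)
      (show 12 + 4 = 16 from rfl), ← cupProduct_map,
    complexGysin_cup hμ hP hA' (AbelianVariety.fst A B).hom.hom.hom (show 12 + 4 = 16 from rfl) _
      (show 4 + 2 * 12 = 0 + 2 * (12 + 2) by norm_num) (Nat.add_zero 12) x] at h12
  set ε := complexGysin μ hP hA' (AbelianVariety.fst A B).hom.hom.hom
    (show 4 + 2 * 12 = 0 + 2 * (12 + 2) by norm_num)
    (complexBetti.map (AbelianVariety.snd A B).hom.hom.hom 4 (cupProduct (show 2 + 2 = 4 from rfl) b η)) with hε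
  -- `ε = t • 1` with `t ≠ 0` (Schoen's surjectivity), so `pr_{A*}(…) = t • x`
  have hε0 : ε ≠ 0 := complexGysin_fst_map_snd_ne_zero μ hA' hB' hbη
  obtain ⟨t, ht⟩ := exists_eq_smul_one μ hA' ε
  have ht0 : t ≠ 0 := by
    rintro rfl
    exact hε0 (by rw [ht, zero_smul])
  rw [ht, map_smul, cupProduct_one] at h12
  have h := Submodule.smul_mem _ t⁻¹ h12
  rwa [smul_smul, inv_mul_cancel₀ ht0, one_smul] at h

/-- `g^*(p^* w) = p'^*(θ^* w)` for homomorphisms with `g ≫ p = p' ≫ θ` (contravariance of `H*(–(ℂ))`;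
the left-hand side in the shape produced by `cupProduct_map`). [folklore] -/
theorem map_map_eq_of_comp_eq {X Y Y' Z : AbelianVariety ℂ} {g : X ⟶ Y} {p : Y ⟶ Z} {p' : X ⟶ Y'}
    {θ : Y' ⟶ Z} (h : g ≫ p = p' ≫ θ) {k : ℕ} (w : complexBetti Z.X k) :
    singularCohomology.map ℂ ℂ (AlgPoints.mapContinuous (L := ℂ) g.hom.hom.hom) k
        (complexBetti.map p.hom.hom.hom k w) =
      complexBetti.map p'.hom.hom.hom k (complexBetti.map θ.hom.hom.hom k w) := by
  change singularCohomology.map ℂ ℂ (AlgPoints.mapContinuous (L := ℂ) g.hom.hom.hom) k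
      (singularCohomology.map ℂ ℂ (AlgPoints.mapContinuous (L := ℂ) p.hom.hom.hom) k w) =
    singularCohomology.map ℂ ℂ (AlgPoints.mapContinuous (L := ℂ) p'.hom.hom.hom) k
      (singularCohomology.map ℂ ℂ (AlgPoints.mapContinuous (L := ℂ) θ.hom.hom.hom) k w)
  rw [abelianVarietyHom_map_map_apply, abelianVarietyHom_map_map_apply, h]

/-- **Schoen 1998 §10, upward half, in the typing `Eig((𝟙+ψ)^*, (1±i√7)¹⁴)`: both Weil eigen-components
`P±± = pr_A^*c± ⌣ pr_B^*b±` of `pr_A^* c ⌣ pr_B^* w` are algebraic on `A × B`** (`A` of dimension `12`,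
`B` of dimension `2`, `ψ = φ × φ_B`), GRANTED Künneth for Hodge types (`hS4`, the registered neighbour
stub) and the algebraicity of the rational `(7,7)`-classes of the typed Weil plane of `(A × B, ψ)`, for
`c = c₊ + c₋` rational `(6,6)`, `c± ∈ Eig((𝟙+φ)^*, λ±¹²)`, `w = b₊ + b₋` rational `(1,1)`, `b± ∈ Eig((𝟙+φ_B)^*, λ±²)`,
`λ± = 1 ± i√7`: `T = (𝟙+ψ)^*` factorwise gives `P = ΣP±±` with pairwise distinct `T`-eigenvalues `λ±¹²λ±'²`;
`Q = T²P - (β+β̄)TP + ββ̄P` (`β = λ₊¹²λ₋²`, `β+β̄ ∈ ℤ`, `ββ̄ = 8¹⁴`) and `TQ` are rational `(7,7)` classes of the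
typed plane, hence algebraic; invert the `2 × 2` system (`mem_and_mem_of_smul_add_smul_mem`).
[cite: Schoen1998HodgeWeilAddendum, §10 (Proposition and proof, pp. 332–333)]
[cite: Markman2025SurveySecant, §11.5 Step 2] [cite: HatcherAT2002, §3.2 Prop. 3.10] -/
theorem eigencomponents_mem_algebraicClasses
    (hS4 : ∀ (A B : AbelianVariety ℂ) (a b : ℕ), A.dim = a → B.dim = b →
      ∀ (k l m : ℕ) (hklm : k + l = m) (p q p' q' : ℕ)
        (c : complexBetti A.X k) (w : complexBetti B.X l),
        IsOfHodgeType a A.X k p q c → IsOfHodgeType b B.X l p' q' w →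
        IsOfHodgeType (a + b) (A.prod B).X m (p + p') (q + q')
          (cupProduct hklm (complexBetti.map (AbelianVariety.fst A B).hom.hom.hom k c)
            (complexBetti.map (AbelianVariety.snd A B).hom.hom.hom l w)))
    {A B : AbelianVariety ℂ} {φ : A ⟶ A} {φB : B ⟶ B} (hA : A.dim = 12) (hB : B.dim = 2)
    (hAB : ∀ u : complexBetti (A.prod B).X 14, IsRationalClass u →
        IsOfHodgeType 14 (A.prod B).X 14 7 7 u →
        u ∈ Module.End.eigenspace (complexBetti.map (𝟙 (A.prod B) +
                AbelianVariety.prodLift (AbelianVariety.fst A B ≫ φ)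
                  (AbelianVariety.snd A B ≫ φB)).hom.hom.hom 14).hom
              ((1 + Complex.I * (Real.sqrt (7 : ℝ) : ℂ)) ^ 14) ⊔
            Module.End.eigenspace (complexBetti.map (𝟙 (A.prod B) +
                AbelianVariety.prodLift (AbelianVariety.fst A B ≫ φ)
                  (AbelianVariety.snd A B ≫ φB)).hom.hom.hom 14).hom
              ((1 - Complex.I * (Real.sqrt (7 : ℝ) : ℂ)) ^ 14) →
        u ∈ algebraicClasses (A.prod B).X 7)
    {cp cm : complexBetti A.X 12} {bp bm : complexBetti B.X 2}
    (hcp : cp ∈ Module.End.eigenspace (complexBetti.map (𝟙 A + φ).hom.hom.hom 12).hom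
      ((1 + Complex.I * (Real.sqrt (7 : ℝ) : ℂ)) ^ 12))
    (hcm : cm ∈ Module.End.eigenspace (complexBetti.map (𝟙 A + φ).hom.hom.hom 12).hom
      ((1 - Complex.I * (Real.sqrt (7 : ℝ) : ℂ)) ^ 12))
    (hbp : bp ∈ Module.End.eigenspace (complexBetti.map (𝟙 B + φB).hom.hom.hom 2).hom
      ((1 + Complex.I * (Real.sqrt (7 : ℝ) : ℂ)) ^ 2))
    (hbm : bm ∈ Module.End.eigenspace (complexBetti.map (𝟙 B + φB).hom.hom.hom 2).hom
      ((1 - Complex.I * (Real.sqrt (7 : ℝ) : ℂ)) ^ 2))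
    (hcr : IsRationalClass (cp + cm)) (hcH : IsOfHodgeType 12 A.X 12 6 6 (cp + cm))
    (hbr : IsRationalClass (bp + bm)) (hbH : IsOfHodgeType 2 B.X 2 1 1 (bp + bm)) :
    cupProduct (show 12 + 2 = 14 from rfl)
        (complexBetti.map (AbelianVariety.fst A B).hom.hom.hom 12 cp)
        (complexBetti.map (AbelianVariety.snd A B).hom.hom.hom 2 bp) ∈ algebraicClasses (A.prod B).X 7 ∧
    cupProduct (show 12 + 2 = 14 from rfl)
        (complexBetti.map (AbelianVariety.fst A B).hom.hom.hom 12 cm)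
        (complexBetti.map (AbelianVariety.snd A B).hom.hom.hom 2 bm) ∈ algebraicClasses (A.prod B).X 7 := by
  have hBX : IsSmoothProjective 14 (A.prod B).X :=
    isSmoothProjective_of_dim_eq (by rw [AbelianVariety.dim_prod, hA, hB])
  -- the two Weil characters at the test endomorphism `𝟙 + φ`
  set sp : ℂ := 1 + Complex.I * (Real.sqrt (7 : ℝ) : ℂ) with hsp
  set sm : ℂ := 1 - Complex.I * (Real.sqrt (7 : ℝ) : ℂ) with hsm
  have hspm : ∀ n : ℕ, 1 ≤ n → sp ^ n ≠ sm ^ n := fun n hn ↦ Negative.one_add_I_sqrt7_pow_ne n hn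
  have hsp0 : sp ≠ 0 := Negative.one_add_I_sqrt7_ne_zero
  have hsm0 : sm ≠ 0 := Negative.one_sub_I_sqrt7_ne_zero
  -- `ψ = φ × φ_B`, `g = 𝟙 + ψ`, `T = g^*` on `H¹⁴((A × B)(ℂ))`, computed FACTORWISE
  set g : A.prod B ⟶ A.prod B := 𝟙 (A.prod B) +
    AbelianVariety.prodLift (AbelianVariety.fst A B ≫ φ) (AbelianVariety.snd A B ≫ φB) with hg
  have hg₁ : g ≫ AbelianVariety.fst A B = AbelianVariety.fst A B ≫ (𝟙 A + φ) := by
    simp [hg, Preadditive.add_comp, Preadditive.comp_add]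
  have hg₂ : g ≫ AbelianVariety.snd A B = AbelianVariety.snd A B ≫ (𝟙 B + φB) := by
    simp [hg, Preadditive.add_comp, Preadditive.comp_add]
  set T : complexBetti (A.prod B).X 14 →ₗ[ℂ] complexBetti (A.prod B).X 14 :=
    (complexBetti.map g.hom.hom.hom 14).hom with hT
  have hTapp : ∀ u : complexBetti (A.prod B).X 14, T u =
      singularCohomology.map ℂ ℂ (Motives.AlgPoints.mapContinuous (L := ℂ) g.hom.hom.hom) 14 u :=
    fun _ ↦ rfl
  -- eigen-equations: of the four factors, and of the four pieces of `P = pr_A^*(c₊+c₋) ∪ pr_B^*(b₊+b₋)`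
  have hcp' : complexBetti.map (𝟙 A + φ).hom.hom.hom 12 cp = sp ^ 12 • cp := Module.End.mem_eigenspace_iff.1 hcp
  have hcm' : complexBetti.map (𝟙 A + φ).hom.hom.hom 12 cm = sm ^ 12 • cm := Module.End.mem_eigenspace_iff.1 hcm
  have hbp' : complexBetti.map (𝟙 B + φB).hom.hom.hom 2 bp = sp ^ 2 • bp := Module.End.mem_eigenspace_iff.1 hbp
  have hbm' : complexBetti.map (𝟙 B + φB).hom.hom.hom 2 bm = sm ^ 2 • bm := Module.End.mem_eigenspace_iff.1 hbm
  have tt : ∀ (x : complexBetti A.X 12) (y : complexBetti B.X 2) (a e : ℂ),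
      complexBetti.map (𝟙 A + φ).hom.hom.hom 12 x = a • x → complexBetti.map (𝟙 B + φB).hom.hom.hom 2 y = e • y →
      T (cupProduct (show 12 + 2 = 14 from rfl) (complexBetti.map (AbelianVariety.fst A B).hom.hom.hom 12 x)
          (complexBetti.map (AbelianVariety.snd A B).hom.hom.hom 2 y)) =
        (a * e) • cupProduct (show 12 + 2 = 14 from rfl) (complexBetti.map (AbelianVariety.fst A B).hom.hom.hom 12 x)
          (complexBetti.map (AbelianVariety.snd A B).hom.hom.hom 2 y) := by
    intro x y a e hx hy
    rw [hTapp, cupProduct_map, map_map_eq_of_comp_eq hg₁, map_map_eq_of_comp_eq hg₂, hx, hy]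
    simp only [map_smul, LinearMap.smul_apply, smul_smul, mul_comm]
  set P : complexBetti (A.prod B).X 14 := cupProduct (show 12 + 2 = 14 from rfl)
    (complexBetti.map (AbelianVariety.fst A B).hom.hom.hom 12 (cp + cm))
    (complexBetti.map (AbelianVariety.snd A B).hom.hom.hom 2 (bp + bm)) with hPdef
  set P₁ : complexBetti (A.prod B).X 14 := cupProduct (show 12 + 2 = 14 from rfl)
    (complexBetti.map (AbelianVariety.fst A B).hom.hom.hom 12 cp)
    (complexBetti.map (AbelianVariety.snd A B).hom.hom.hom 2 bp) with hP₁
  set P₂ : complexBetti (A.prod B).X 14 := cupProduct (show 12 + 2 = 14 from rfl)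
    (complexBetti.map (AbelianVariety.fst A B).hom.hom.hom 12 cm)
    (complexBetti.map (AbelianVariety.snd A B).hom.hom.hom 2 bm) with hP₂
  have hP : P = P₁ + P₂ +
      cupProduct (show 12 + 2 = 14 from rfl) (complexBetti.map (AbelianVariety.fst A B).hom.hom.hom 12 cp)
        (complexBetti.map (AbelianVariety.snd A B).hom.hom.hom 2 bm) +
      cupProduct (show 12 + 2 = 14 from rfl) (complexBetti.map (AbelianVariety.fst A B).hom.hom.hom 12 cm)
        (complexBetti.map (AbelianVariety.snd A B).hom.hom.hom 2 bp) := by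
    simp only [hPdef, hP₁, hP₂, map_add, LinearMap.add_apply]
    abel
  have t₁ : T P₁ = (sp ^ 12 * sp ^ 2) • P₁ := tt _ _ _ _ hcp' hbp'
  have t₂ : T P₂ = (sm ^ 12 * sm ^ 2) • P₂ := tt _ _ _ _ hcm' hbm'
  -- `P₊₊`, `P₋₋` and their combinations lie in the typed Weil plane of `A × B` (`λ±¹² λ±² = λ±¹⁴`)
  have hP₁E : P₁ ∈ Module.End.eigenspace T (sp ^ 14) := by rw [Module.End.mem_eigenspace_iff, t₁, ← pow_add]
  have hP₂E : P₂ ∈ Module.End.eigenspace T (sm ^ 14) := by rw [Module.End.mem_eigenspace_iff, t₂, ← pow_add]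
  have hW : ∀ a e : ℂ, a • P₁ + e • P₂ ∈ Module.End.eigenspace T (sp ^ 14) ⊔ Module.End.eigenspace T (sm ^ 14) :=
    fun a e ↦ Submodule.add_mem _ (Submodule.mem_sup_left (Submodule.smul_mem _ _ hP₁E))
      (Submodule.mem_sup_right (Submodule.smul_mem _ _ hP₂E))
  -- the projector `Q = q(T) P`, `q(X) = (X - β)(X - β')`, `β, β'` the two mixed eigenvalues
  set α : ℂ := sp ^ 12 * sp ^ 2 with hα
  set α' : ℂ := sm ^ 12 * sm ^ 2 with hα'
  set β : ℂ := sp ^ 12 * sm ^ 2 with hβ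
  set β' : ℂ := sm ^ 12 * sp ^ 2 with hβ'
  set Q : complexBetti (A.prod B).X 14 := T (T P) - (β + β') • T P + (β * β') • P with hQdef
  have hQ : Q = ((α - β) * (α - β')) • P₁ + ((α' - β) * (α' - β')) • P₂ :=
    weilProjector_eq T hP t₁ t₂ (tt _ _ _ _ hcp' hbm') (tt _ _ _ _ hcm' hbp')
  have hTQ : T Q = (α * ((α - β) * (α - β'))) • P₁ + (α' * ((α' - β) * (α' - β'))) • P₂ :=
    weilProjector_map_eq T hP t₁ t₂ (tt _ _ _ _ hcp' hbm') (tt _ _ _ _ hcm' hbp')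
  -- `Q`, `TQ` are rational: `P` is, `T` preserves rationality, `β + β' ∈ ℤ`, `ββ' = 8¹⁴`
  have hPr : IsRationalClass P := (hcr.map _).cup _ (hbr.map _)
  have hTPr : IsRationalClass (T P) := by rw [hTapp]; exact hPr.map _
  have hTTPr : IsRationalClass (T (T P)) := by rw [hTapp]; exact hTPr.map _
  have hsum : sp + sm = ((2 : ℤ) : ℂ) := by rw [hsp, hsm]; push_cast; ring
  have hprod : sp * sm = ((8 : ℤ) : ℂ) := by
    rw [hsp, hsm]
    push_cast
    linear_combination (-(((Real.sqrt (7 : ℝ) : ℝ) : ℂ) * ((Real.sqrt (7 : ℝ) : ℝ) : ℂ))) * Complex.I_mul_I +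
      Negative.sqrt7_mul_sqrt7
  obtain ⟨zs, hzs⟩ : ∃ z : ℤ, (z : ℂ) = β + β' := exists_intCast_eq_pow_mul_pow_add hsum hprod 12 2
  obtain ⟨zt, hzt⟩ : ∃ z : ℤ, (z : ℂ) = β * β' := ⟨8 ^ 14, by rw [Int.cast_pow, ← hprod, hβ, hβ']; ring⟩
  have hQr : IsRationalClass Q := by
    have e : Q = T (T P) + (((-zs : ℤ) : ℚ) : ℂ) • T P + (((zt : ℤ) : ℚ) : ℂ) • P := by
      rw [hQdef, Rat.cast_intCast, Rat.cast_intCast, Int.cast_neg, hzs, hzt, neg_smul, ← sub_eq_add_neg]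
    rw [e]
    exact (hTTPr.add (hTPr.smul _)).add (hPr.smul _)
  have hTQr : IsRationalClass (T Q) := by rw [hTapp]; exact hQr.map _
  -- `Q`, `TQ` are of Hodge type `(7,7)`: `P` is (Künneth for Hodge types, the premise), and the
  -- endomorphism `g` preserves the `(p,q)`-classes of the Hodge model `M` of `A × B` witnessing it
  obtain ⟨M, hM⟩ : IsOfHodgeType 14 (A.prod B).X 14 7 7 P :=
    hS4 A B 12 2 hA hB 12 2 14 rfl 6 6 1 1 (cp + cm) (bp + bm) hcH hbH
  have hstab : ∀ u : complexBetti (A.prod B).X 14, M.pullback 14 u ∈ M.hodgePQ 14 7 7 →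
      M.pullback 14 (T u) ∈ M.hodgePQ 14 7 7 := fun u hu ↦ by
    rw [hTapp]
    exact M.pullback_map_mem_hodgePQ_of_endomorphism hBX g.hom.hom.hom hu
  have hMP : P ∈ (M.hodgePQ 14 7 7).comap (M.pullback 14).hom := hM
  have hMQ : Q ∈ (M.hodgePQ 14 7 7).comap (M.pullback 14).hom := by
    rw [hQdef]
    exact Submodule.add_mem _ (Submodule.sub_mem _ (hstab _ (hstab _ hMP))
      (Submodule.smul_mem _ _ (hstab _ hMP))) (Submodule.smul_mem _ _ hMP)
  -- hence both are algebraic (the hypothesis on the 14-fold), and the `2 × 2` system is inverted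
  have hQalg : Q ∈ algebraicClasses (A.prod B).X 7 := hAB Q hQr ⟨M, hMQ⟩ (hQ ▸ hW _ _)
  have hTQalg : T Q ∈ algebraicClasses (A.prod B).X 7 := hAB (T Q) hTQr ⟨M, hstab _ hMQ⟩ (hTQ ▸ hW _ _)
  rw [hQ] at hQalg
  rw [hTQ] at hTQalg
  have hne : α ≠ α' := by
    rw [hα, hα', ← pow_add, ← pow_add]
    exact hspm 14 (by norm_num)
  refine mem_and_mem_of_smul_add_smul_mem (algebraicClasses (A.prod B).X 7) hne ?_ ?_ hQalg hTQalg
  · refine mul_ne_zero ?_ ?_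
    · rw [hα, hβ, ← mul_sub]
      exact mul_ne_zero (pow_ne_zero _ hsp0) (sub_ne_zero.mpr (hspm 2 (by norm_num)))
    · rw [hα, hβ', ← sub_mul]
      exact mul_ne_zero (sub_ne_zero.mpr (hspm 12 (by norm_num))) (pow_ne_zero _ hsp0)
  · refine mul_ne_zero ?_ ?_
    · rw [hα', hβ, ← sub_mul]
      exact mul_ne_zero (sub_ne_zero.mpr (hspm 12 (by norm_num)).symm) (pow_ne_zero _ hsm0)
    · rw [hα', hβ', ← mul_sub]
      exact mul_ne_zero (pow_ne_zero _ hsm0) (sub_ne_zero.mpr (hspm 2 (by norm_num)).symm)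

/-- **Stub `stub_descent` (S5) of line `amnesic-secant-sheaves-split-fourteenfolds`, crux
`WeilTwelvefoldsSqrtMinus7` (stmt-HodgeConjecture-1261): Schoen's descent `14 → 12` for ONE partner surface
`(B, φ_B)` with a descent pair `(b₊, b₋, η)`, GIVEN Künneth for Hodge types (the premise = the registered
statement of `stub_hodgeTypeExterior`).** For `c = c₊ + c₋` rational `(6,6)` in the typed Weil plane of the
12-fold `(A, φ)`: `P±± = pr_A^*c± ⌣ pr_B^*b±` are algebraic on `A × B` (`eigencomponents_mem_algebraicClasses`)
and Schoen's transfer `pr_{A*}(P±± ⌣ pr_B^*η) = ε± · c±`, `ε± ≠ 0` (`mem_algebraicClasses_of_transfer`) returns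
`c±`. (The Weil relations `φ² = φ_B² = -7` are not used: the eigen-hypotheses carry them.)
[cite: Schoen1998HodgeWeilAddendum, §10 Proposition (proof)] [cite: Markman2025SurveySecant, §11.5 Step 2] -/
theorem stub_descent :
    (∀ (A B : AbelianVariety ℂ) (a b : ℕ), A.dim = a → B.dim = b →
      ∀ (k l m : ℕ) (hklm : k + l = m) (p q p' q' : ℕ)
        (c : complexBetti A.X k) (w : complexBetti B.X l),
        IsOfHodgeType a A.X k p q c → IsOfHodgeType b B.X l p' q' w →
        IsOfHodgeType (a + b) (A.prod B).X m (p + p') (q + q')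
          (cupProduct hklm (complexBetti.map (AbelianVariety.fst A B).hom.hom.hom k c)
            (complexBetti.map (AbelianVariety.snd A B).hom.hom.hom l w))) →
    ∀ (A : AbelianVariety ℂ) (φ : A ⟶ A) (B : AbelianVariety ℂ) (φB : B ⟶ B),
      A.dim = 12 → B.dim = 2 → φ ≫ φ = -((7 : ℤ) • 𝟙 A) → φB ≫ φB = -((7 : ℤ) • 𝟙 B) →
      (∃ bp bm η : complexBetti B.X 2,
        bp ∈ Module.End.eigenspace (complexBetti.map (𝟙 B + φB).hom.hom.hom 2).hom
              ((1 + Complex.I * (Real.sqrt (7 : ℝ) : ℂ)) ^ 2) ∧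
        bm ∈ Module.End.eigenspace (complexBetti.map (𝟙 B + φB).hom.hom.hom 2).hom
              ((1 - Complex.I * (Real.sqrt (7 : ℝ) : ℂ)) ^ 2) ∧
        IsRationalClass (bp + bm) ∧ IsOfHodgeType 2 B.X 2 1 1 (bp + bm) ∧
        η ∈ algebraicClasses B.X 1 ∧
        cupProduct (show 2 + 2 = 4 from rfl) bp η ≠ 0 ∧
        cupProduct (show 2 + 2 = 4 from rfl) bm η ≠ 0) →
      (∀ u : complexBetti (A.prod B).X 14, IsRationalClass u →
        IsOfHodgeType 14 (A.prod B).X 14 7 7 u →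
        u ∈ Module.End.eigenspace (complexBetti.map (𝟙 (A.prod B) +
                AbelianVariety.prodLift (AbelianVariety.fst A B ≫ φ)
                  (AbelianVariety.snd A B ≫ φB)).hom.hom.hom 14).hom
              ((1 + Complex.I * (Real.sqrt (7 : ℝ) : ℂ)) ^ 14) ⊔
            Module.End.eigenspace (complexBetti.map (𝟙 (A.prod B) +
                AbelianVariety.prodLift (AbelianVariety.fst A B ≫ φ)
                  (AbelianVariety.snd A B ≫ φB)).hom.hom.hom 14).hom
              ((1 - Complex.I * (Real.sqrt (7 : ℝ) : ℂ)) ^ 14) →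
        u ∈ algebraicClasses (A.prod B).X 7) →
      ∀ c : complexBetti A.X 12, IsRationalClass c → IsOfHodgeType 12 A.X 12 6 6 c →
        c ∈ Module.End.eigenspace (complexBetti.map (𝟙 A + φ).hom.hom.hom 12).hom
              ((1 + Complex.I * (Real.sqrt (7 : ℝ) : ℂ)) ^ 12) ⊔
            Module.End.eigenspace (complexBetti.map (𝟙 A + φ).hom.hom.hom 12).hom
              ((1 - Complex.I * (Real.sqrt (7 : ℝ) : ℂ)) ^ 12) →
        c ∈ algebraicClasses A.X 6 := by
  intro hS4 A φ B φB hA hB _ _ hpair hAB c hcr hcH hcW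
  obtain ⟨bp, bm, η, hbp, hbm, hbr, hbH, hη, hbpη, hbmη⟩ := hpair
  obtain ⟨cp, hcp, cm, hcm, rfl⟩ := Submodule.mem_sup.1 hcW
  obtain ⟨hPP, hMM⟩ := eigencomponents_mem_algebraicClasses hS4 hA hB hAB hcp hcm hbp hbm hcr hcH hbr hbH
  exact Submodule.add_mem _ (mem_algebraicClasses_of_transfer hA hB hη hbpη hPP)
    (mem_algebraicClasses_of_transfer hA hB hη hbmη hMM)

end Summit.HodgeConjecture.HodgeConjecture.Theorems.WeilTwelvefoldsSqrtMinus7.AmnesicSecantSheaves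

end
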